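import Mathlib
import HarnessLib
import Literature.Combinatorics.Additive.Vosper

/-!
# Sets with small sumset in `ℤ/pℤ` up to `|2A| ≤ 3p/4`: the `3k − 4`-type theorem of
# Candela–González-Sánchez–Grynkiewicz (2021), Theorem 1.3

P. Candela, D. González-Sánchez, D. J. Grynkiewicz, *On sets with small sumset and `m`-sum-free sets
in `ℤ/pℤ`*, Bull. Soc. Math. France 149 (2021) 155–177 (arXiv:1909.07967; held as
`paper:arxiv-1909.07967`, pp. 2–3 read 2026-08-28).  Toward the `3k − 4` conjecture in `ℤ/pℤ`
(their Conjecture 1.2: `2A ≠ ℤ/pℤ` and `|2A| = 2|A| + r ≤ min{3|A| − 4, p − r − 4}` should force `A`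
into a progression of size `≤ |A| + r + 1` and a progression of size `≥ 2|A| − 1` inside `2A`), the
paper proves the conclusion for doubling up to `2 + α`, `α ≈ 0.136861` the real root of
`4x³ + 9x² + 6x − 1`, under the single density constraint `|2A| ≤ 3p/4`
[cite: CandelaGonzalezSanchezGrynkiewicz2021, Theorem 1.3].  This is the high-density regime: NO upper
bound on `|A|` beyond what `|2A| ≤ 3p/4` implies (contrast the tree's PROVED low-density theorems
`freiman_rectification`, `lev_shkredov_sum` in `SmallDoublingBeyondTwoPointFour.lean`, which need
`|A| < p/12`, `|A| < 0.0045p`).  The proof (§§2–4 of the source: Grynkiewicz's version of the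
Freiman–Vosper isoperimetric machinery, Serra–Zémor, and a Fourier-analytic lemma) is NOT formalised
here — the theorem is vendored as a named fact for the Parity ideation cell (parity-ideate-p4 ROUND-5
§2.5 / §4, line U1, task T6-1: the Kneser slices `A_c` of a 4-point-free set have `|A_c| ≈ 0.21p`,
`|2A_c| ≈ 0.45p ≤ 3p/4`), stated in the vocabulary of `Vosper.lean` (`apFinset a d n` = the progression
`{a + i•d : i < n}`).

Also vendored (T6-1, second half): the companion **Theorem 1.4** [cite:
CandelaGonzalezSanchezGrynkiewicz2021, Theorem 1.4] (p. 3 of the arXiv version, read 2026-08-28: "optimized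
for sets `A` whose density is large but at most `1/3`"), with its density-dependent constant
`α(η, p) = −5/4 + ¼√(9 + 8ηp sin(π/p)/sin(πη/3))` (`cggAlpha`), the PROVED elementary bound
`α(η, p) ≥ 0.185` for `p ≥ 60` (`cggAlpha_ge`; not stated in the source) and the consumer form
`CandelaGonzalezSanchezGrynkiewicz2021_theorem14.of_ge` (doubling `2.185`, `|A| + |2A| ≤ p`, `d ≠ 0`);
statement and proofs of this block contributed by the planner seat parity-ideate-p4 (HOME sketch
`CGG14_patch.lean`, 2026-08-28), checked and filed here.

What IS proved here: the location of the constant (`0.13686 < α < 0.13687` for every real root of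
the cubic, and existence of a root, so the fact is not vacuous and can be consumed with the rational
constant `2.13686`), and the consumer form `CandelaGonzalezSanchezGrynkiewicz2021_theorem13.of_rat`
with a NONZERO common difference (automatic: the hypotheses force `|A| ≥ 2`).
-/

open Finset Real
open scoped Pointwise

namespace Literature.Combinatorics.Additive

/-- **Candela–González-Sánchez–Grynkiewicz 2021, Theorem 1.3** (as printed): "Let `p` be prime, let
`A ⊆ ℤ/pℤ` be a nonempty subset with `|2A| = 2|A| + r`, and let `α ≈ 0.136861` be the unique real
root of the cubic `4x³ + 9x² + 6x − 1`. Suppose `|2A| ≤ (2 + α)|A| − 3` and `|2A| ≤ (3/4) p`. Then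
there exist arithmetic progressions `P_A, P_{2A} ⊆ ℤ/pℤ` with the same difference such that
`A ⊆ P_A`, `|P_A| ≤ |A| + r + 1`, `P_{2A} ⊆ 2A`, and `|P_{2A}| ≥ 2|A| − 1`."
Rendering: `2A = A + A` (Finset sum in `ZMod p`); `|A| + r + 1 = |2A| − |A| + 1`; the constant is
quantified as "every real `α` with `4α³ + 9α² + 6α − 1 = 0`" (the cubic has exactly one real root,
see `cgg_cubic_root_bounds`, so this is the printed statement); the progressions are written with the
tree's `apFinset` (`Vosper.lean`): `P_A = apFinset a d (|2A| − |A| + 1) ⊇ A` (a progression with at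
most `|A| + r + 1` terms) and `apFinset b d (2|A| − 1) ⊆ 2A` (the first `2|A| − 1` terms of `P_{2A}`),
same `d`.  That `d ≠ 0` and that these progressions have distinct terms is automatic under the
hypotheses (`|A| ≥ 2`, `|2A| ≤ 3p/4 < p`) — see `.of_rat` below; it is not written into the fact.
[cite: CandelaGonzalezSanchezGrynkiewicz2021, Theorem 1.3] -/
def CandelaGonzalezSanchezGrynkiewicz2021_theorem13 : Prop :=
  ∀ α : ℝ, 4 * α ^ 3 + 9 * α ^ 2 + 6 * α - 1 = 0 →
    ∀ (p : ℕ), p.Prime → ∀ A : Finset (ZMod p), A.Nonempty →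
      (#(A + A) : ℝ) ≤ (2 + α) * #A - 3 → 4 * #(A + A) ≤ 3 * p →
        ∃ a b d : ZMod p, A ⊆ apFinset a d (#(A + A) - #A + 1) ∧ apFinset b d (2 * #A - 1) ⊆ A + A

/-- The cubic `4x³ + 9x² + 6x − 1` of Theorem 1.3 has all its real roots in
`(0.13686, 0.13687)` (in fact exactly one; the source quotes `α ≈ 0.136861`).
[cite: CandelaGonzalezSanchezGrynkiewicz2021, Theorem 1.3] -/
theorem cgg_cubic_root_bounds {α : ℝ} (h : 4 * α ^ 3 + 9 * α ^ 2 + 6 * α - 1 = 0) :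
    (13686 / 100000 : ℝ) < α ∧ α < 13687 / 100000 := by
  have hpos : 0 < α := by
    by_contra hle
    push Not at hle
    nlinarith [sq_nonneg (α + 9 / 8), mul_nonneg_of_nonpos_of_nonpos hle hle]
  constructor
  · by_contra hle
    push Not at hle
    -- `f` is increasing on `[0, ∞)` and `f(0.13686) < 0`
    have hd : 0 ≤ (13686 / 100000 : ℝ) - α := sub_nonneg.2 hle
    nlinarith [mul_nonneg hd (by positivity :
      (0 : ℝ) ≤ 4 * (α ^ 2 + α * (13686 / 100000) + (13686 / 100000) ^ 2) + 9 * (α + 13686 / 100000) + 6)]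
  · by_contra hle
    push Not at hle
    have hd : 0 ≤ α - (13687 / 100000 : ℝ) := sub_nonneg.2 hle
    nlinarith [mul_nonneg hd (by positivity :
      (0 : ℝ) ≤ 4 * (α ^ 2 + α * (13687 / 100000) + (13687 / 100000) ^ 2) + 9 * (α + 13687 / 100000) + 6)]

/-- The cubic of Theorem 1.3 has a real root (between `0.13686` and `0.13687`), so the named fact is
not vacuously quantified. [cite: CandelaGonzalezSanchezGrynkiewicz2021, Theorem 1.3] -/
theorem cgg_cubic_root_exists :
    ∃ α : ℝ, (13686 / 100000 : ℝ) < α ∧ α < 13687 / 100000 ∧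
      4 * α ^ 3 + 9 * α ^ 2 + 6 * α - 1 = 0 := by
  set f : ℝ → ℝ := fun x => 4 * x ^ 3 + 9 * x ^ 2 + 6 * x - 1 with hf
  have hcont : ContinuousOn f (Set.Icc (13686 / 100000 : ℝ) (13687 / 100000)) := by
    apply Continuous.continuousOn
    simp only [hf]
    fun_prop
  have hle : (13686 / 100000 : ℝ) ≤ 13687 / 100000 := by norm_num
  have h0 : (0 : ℝ) ∈ Set.Icc (f (13686 / 100000)) (f (13687 / 100000)) := by
    simp only [hf, Set.mem_Icc]
    constructor <;> norm_num
  obtain ⟨α, hα, hfα⟩ := intermediate_value_Icc hle hcont h0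
  have hroot : 4 * α ^ 3 + 9 * α ^ 2 + 6 * α - 1 = 0 := by simpa [hf] using hfα
  obtain ⟨h1, h2⟩ := cgg_cubic_root_bounds hroot
  exact ⟨α, h1, h2, hroot⟩

/-- A progression with common difference `0` is contained in a singleton. [folklore] -/
private theorem apFinset_zero_diff_subset {p : ℕ} (a : ZMod p) (n : ℕ) :
    apFinset a (0 : ZMod p) n ⊆ {a} := by
  intro x hx
  obtain ⟨i, -, rfl⟩ := mem_apFinset.1 hx
  simp

/-- **Consumer form of Theorem 1.3** with the rational constant `2.13686 < 2 + α` and a NONZERO common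
difference: for `p` prime and `A ⊆ ℤ/pℤ` nonempty with `|2A| ≤ 2.13686·|A| − 3` and `4|2A| ≤ 3p`,
there are `a, b, d ∈ ℤ/pℤ`, `d ≠ 0`, with `A ⊆ {a + i d : i < |2A| − |A| + 1}` and
`{b + i d : i < 2|A| − 1} ⊆ 2A` (the latter progression then has exactly `2|A| − 1` elements, by
`card_apFinset`, since `2|A| − 1 ≤ |2A| ≤ 3p/4`).  Derived from the named fact: the cubic's root exceeds
`0.13686` (`cgg_cubic_root_bounds`), and `d = 0` would force `A ⊆ {a}`, `|A| = 1`, contradicting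
`|2A| ≤ 2.13686·|A| − 3 < 0`. [cite: CandelaGonzalezSanchezGrynkiewicz2021, Theorem 1.3] -/
theorem CandelaGonzalezSanchezGrynkiewicz2021_theorem13.of_rat
    (h : CandelaGonzalezSanchezGrynkiewicz2021_theorem13) {p : ℕ} [hp : Fact p.Prime]
    {A : Finset (ZMod p)} (hA : A.Nonempty)
    (h2A : (#(A + A) : ℝ) ≤ (2 + 13686 / 100000) * #A - 3) (h34 : 4 * #(A + A) ≤ 3 * p) :
    ∃ a b d : ZMod p, d ≠ 0 ∧ A ⊆ apFinset a d (#(A + A) - #A + 1) ∧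
      apFinset b d (2 * #A - 1) ⊆ A + A := by
  obtain ⟨α, hα1, -, hroot⟩ := cgg_cubic_root_exists
  have hcardA : (0 : ℝ) ≤ #A := Nat.cast_nonneg _
  have h2A' : (#(A + A) : ℝ) ≤ (2 + α) * #A - 3 := by nlinarith
  obtain ⟨a, b, d, hAP, h2AP⟩ := h α hroot p hp.out A hA h2A' h34
  refine ⟨a, b, d, ?_, hAP, h2AP⟩
  rintro rfl
  -- `d = 0`: then `A ⊆ {a}`, so `|A| = 1`, and the doubling hypothesis is absurd
  have hA1 : #A ≤ 1 := by
    calc #A ≤ #({a} : Finset (ZMod p)) :=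
          card_le_card (hAP.trans (apFinset_zero_diff_subset a _))
      _ = 1 := card_singleton a
  have hA1' : (#A : ℝ) ≤ 1 := by exact_mod_cast hA1
  have hAA : (1 : ℝ) ≤ #(A + A) := by
    have : (A + A).Nonempty := hA.add hA
    exact_mod_cast this.card_pos
  linarith

/-- The constant of Candela–González-Sánchez–Grynkiewicz 2021, Theorem 1.4:
`α(η, p) = −5/4 + ¼ · √(9 + 8 η p sin(π/p) / sin(π η / 3))`.
[cite: CandelaGonzalezSanchezGrynkiewicz2021, Theorem 1.4] -/
noncomputable def cggAlpha (η : ℝ) (p : ℕ) : ℝ :=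
  -5 / 4 + 1 / 4 * Real.sqrt (9 + 8 * η * p * Real.sin (π / p) / Real.sin (π * η / 3))

/-- **Candela–González-Sánchez–Grynkiewicz 2021, Theorem 1.4** (as printed): "Let `p` be prime, let
`η ∈ (0,1)`, let `A ⊆ ℤ/pℤ` be a set with `|A| ≥ ηp > 0` and `|2A| = 2|A| + r < p`, and let
`α = −5/4 + ¼√(9 + 8ηp sin(π/p)/sin(πη/3))`. Suppose `|2A| ≤ (2+α)|A| − 3` and `|A| ≤ (p−r)/3`. Then
there exist arithmetic progressions `P_A, P_{2A} ⊆ ℤ/pℤ` with the same difference such that `A ⊆ P_A`,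
`|P_A| ≤ |A| + r + 1`, `P_{2A} ⊆ 2A`, and `|P_{2A}| ≥ 2|A| − 1`."
Rendering (as for Theorem 1.3 above): `|A| ≥ ηp > 0` is `η * p ≤ #A` (`ηp > 0` is automatic from
`0 < η` and `p` prime); `|2A| = 2|A| + r < p` is `#(A + A) < p`; `|A| ≤ (p − r)/3` with
`r = |2A| − 2|A|` is `#A + #(A + A) ≤ p`; the progressions are `apFinset a d (|2A| − |A| + 1) ⊇ A` and
`apFinset b d (2|A| − 1) ⊆ 2A`, same `d` (`d ≠ 0` automatic, see `.of_ge`).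
[cite: CandelaGonzalezSanchezGrynkiewicz2021, Theorem 1.4] -/
def CandelaGonzalezSanchezGrynkiewicz2021_theorem14 : Prop :=
  ∀ (p : ℕ), p.Prime → ∀ η : ℝ, 0 < η → η < 1 → ∀ A : Finset (ZMod p), η * p ≤ #A →
    #(A + A) < p → (#(A + A) : ℝ) ≤ (2 + cggAlpha η p) * #A - 3 → #A + #(A + A) ≤ p →
      ∃ a b d : ZMod p, A ⊆ apFinset a d (#(A + A) - #A + 1) ∧ apFinset b d (2 * #A - 1) ⊆ A + A

/-- The constant of Theorem 1.4 is at least `0.185` for every `η ∈ (0,1)` once `p ≥ 60` (elementary: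
`sin(πη/3) ≤ πη/3` and `p sin(π/p) ≥ π − π³/(6p²)` give `α(η,p) ≥ −5/4 + ¼√(33 − 4π²/p²)`; the source
does not state this bound — it is a PROVED consumer lemma). [cite: CandelaGonzalezSanchezGrynkiewicz2021, Theorem 1.4] -/
theorem cggAlpha_ge {p : ℕ} (hp : 60 ≤ p) {η : ℝ} (hη0 : 0 < η) (hη1 : η < 1) :
    (37 : ℝ) / 200 ≤ cggAlpha η p := by
  have hπ2 : π < 3.15 := Real.pi_lt_d2
  have hπ0 : (0 : ℝ) < π := Real.pi_pos
  have hpR : (60 : ℝ) ≤ p := by exact_mod_cast hp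
  have hp0 : (0 : ℝ) < p := by linarith
  set x : ℝ := π / p with hx
  have hx0 : 0 < x := div_pos hπ0 hp0
  have hx1 : x ≤ 1 / 19 := by
    rw [hx, div_le_iff₀ hp0]
    linarith
  have hs1 : x - x ^ 3 / 6 < Real.sin x := Real.sin_gt_sub_cube hx0
  set y : ℝ := π * η / 3 with hy
  have hy0 : 0 < y := by rw [hy]; positivity
  have hyπ : y < π := by rw [hy]; nlinarith
  have hs2 : 0 < Real.sin y := Real.sin_pos_of_pos_of_lt_pi hy0 hyπ
  have hs2' : Real.sin y ≤ y := Real.sin_le hy0.le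
  have hsx0 : 0 < Real.sin x := by
    have hx2' : x ^ 2 < 6 := by nlinarith [hx0, hx1]
    have hx3 : x ^ 3 / 6 < x := by
      rw [div_lt_iff₀ (by norm_num : (0:ℝ) < 6)]
      nlinarith [mul_pos hx0 (sub_pos.mpr hx2')]
    linarith [hs1, hx3]
  have hnum : 0 ≤ 8 * η * p * Real.sin x := by positivity
  have hR : 8 * η * p * Real.sin x / y ≤ 8 * η * p * Real.sin x / Real.sin y :=
    div_le_div_of_nonneg_left hnum hs2 hs2'
  have hR2 : 8 * η * p * Real.sin x / y = 24 / π * (p * Real.sin x) := by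
    rw [hy]
    field_simp
    ring
  have hps : π * (1 - x ^ 2 / 6) ≤ p * Real.sin x := by
    have e : (p : ℝ) * x = π := by rw [hx]; field_simp
    have h1 : (p : ℝ) * (x - x ^ 3 / 6) ≤ p * Real.sin x := mul_le_mul_of_nonneg_left hs1.le hp0.le
    calc π * (1 - x ^ 2 / 6) = p * x * (1 - x ^ 2 / 6) := by rw [e]
      _ = p * (x - x ^ 3 / 6) := by ring
      _ ≤ p * Real.sin x := h1
  have hx2 : x ^ 2 ≤ 1 / 361 := by nlinarith [hx0, hx1]
  have hlow : (24 : ℝ) * (1 - 1 / 2166) ≤ 24 / π * (p * Real.sin x) := by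
    have h1 : 24 / π * (π * (1 - x ^ 2 / 6)) ≤ 24 / π * (p * Real.sin x) :=
      mul_le_mul_of_nonneg_left hps (by positivity)
    have h2 : 24 / π * (π * (1 - x ^ 2 / 6)) = 24 * (1 - x ^ 2 / 6) := by
      field_simp
    rw [h2] at h1
    nlinarith [h1, hx2]
  have hX : (574 / 100 : ℝ) ^ 2 ≤ 9 + 8 * η * p * Real.sin x / Real.sin y := by
    rw [hR2] at hR
    have h0 : (574 / 100 : ℝ) ^ 2 ≤ 9 + 24 * (1 - 1 / 2166) := by norm_num
    linarith [hR, hlow]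
  have hsqrt : (574 / 100 : ℝ) ≤ Real.sqrt (9 + 8 * η * p * Real.sin x / Real.sin y) := by
    have h1 := Real.sqrt_le_sqrt hX
    rwa [Real.sqrt_sq (by norm_num)] at h1
  show (37 : ℝ) / 200 ≤ -5 / 4 + 1 / 4 * Real.sqrt (9 + 8 * η * p * Real.sin (π / p) / Real.sin (π * η / 3))
  rw [← hx, ← hy]
  linarith [hsqrt]

/-- **Consumer form of Theorem 1.4** for primes `p ≥ 60` with the rational constant `2.185` and a NONZERO
common difference: for `A ⊆ ℤ/pℤ` nonempty with `|2A| ≤ 2.185·|A| − 3` and `|A| + |2A| ≤ p` there are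
`a, b, d`, `d ≠ 0`, with `A ⊆ {a + i d : i < |2A| − |A| + 1}` and `{b + i d : i < 2|A| − 1} ⊆ 2A`
(take `η = |A|/p` in Theorem 1.4 and use `cggAlpha_ge`).
[cite: CandelaGonzalezSanchezGrynkiewicz2021, Theorem 1.4] -/
theorem CandelaGonzalezSanchezGrynkiewicz2021_theorem14.of_ge
    (h : CandelaGonzalezSanchezGrynkiewicz2021_theorem14) {p : ℕ} [hp : Fact p.Prime] (hp60 : 60 ≤ p)
    {A : Finset (ZMod p)} (hA : A.Nonempty)
    (h2A : (#(A + A) : ℝ) ≤ (2 + 37 / 200) * #A - 3) (h3 : #A + #(A + A) ≤ p) :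
    ∃ a b d : ZMod p, d ≠ 0 ∧ A ⊆ apFinset a d (#(A + A) - #A + 1) ∧
      apFinset b d (2 * #A - 1) ⊆ A + A := by
  have hp0 : (0 : ℝ) < p := by exact_mod_cast hp.out.pos
  have hA1 : 1 ≤ #A := Finset.card_pos.mpr hA
  have hAA1 : 1 ≤ #(A + A) := Finset.card_pos.mpr (hA.add hA)
  have hAp : #A < p := by omega
  set η : ℝ := #A / p with hη
  have hη0 : 0 < η := by rw [hη]; exact div_pos (by exact_mod_cast hA1) hp0
  have hη1 : η < 1 := by
    rw [hη, div_lt_one hp0]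
    exact_mod_cast hAp
  have hηA : η * p ≤ #A := by rw [hη, div_mul_cancel₀ _ hp0.ne']
  have hlt : #(A + A) < p := by omega
  have hα := cggAlpha_ge hp60 hη0 hη1
  have h2A' : (#(A + A) : ℝ) ≤ (2 + cggAlpha η p) * #A - 3 := by
    have hA0 : (0 : ℝ) ≤ #A := Nat.cast_nonneg _
    nlinarith [h2A, hα, hA0]
  obtain ⟨a, b, d, hAP, h2AP⟩ := h p hp.out η hη0 hη1 A hηA hlt h2A' h3
  refine ⟨a, b, d, ?_, hAP, h2AP⟩
  rintro rfl
  have hA1' : #A ≤ 1 := by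
    calc #A ≤ #({a} : Finset (ZMod p)) :=
          card_le_card (hAP.trans (apFinset_zero_diff_subset a _))
      _ = 1 := card_singleton a
  have hA1'' : (#A : ℝ) ≤ 1 := by exact_mod_cast hA1'
  have hAA : (1 : ℝ) ≤ #(A + A) := by exact_mod_cast hAA1
  linarith

end Literature.Combinatorics.Additive
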